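import Summits.AnomalousDissipation.AnomalousDissipation.Theses.LandauJetArena
import Literature.Analysis.FluidPDE.DoeringFoias
import Literature.Analysis.FluidPDE.LongTimeAverageNonneg

/-!
# Birth skeleton of the ∃-piece `JetPairNoLeakFamily` — line `energy-equality-family` (crux-strategist, stmt-AnomalousDissipation-1540)

The ∃-piece of the split of `LandauJetArena.JetPairZerothLaw` (bounded-energy zero-momentum NO-LEAK family,
body verbatim as filed in `children.json`; after `route edit --split` it is the route decl
`…Theses.LandauJetArena.JetPairNoLeakFamily` and `JetPairNoLeakFamily_of` re-points by name).

LINE (energy-equality transfer). The no-leak clause `θ⟨f·u_j⟩ ≤ ν_j⟨‖∇u_j‖²⟩` is AUTOMATIC (with `θ = 1`)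
for Leray–Hopf solutions satisfying the ENERGY EQUALITY, a standard notion with checkable sufficient criteria
on the constructed solutions (Lions 1960 / Shinbrot 1974 `L^q_t L^p_x`, `2/q + 2/p ≤ 1`, `p ≥ 4`;
Cheskidov–Constantin–Friedlander–Shvydkoy 2008, `L³_t B^{1/3}_{3,c₀}`). So the piece follows from:
`stub_energyEqualityBoundedFamily` (HARDEST: for some jet pair, at every small viscosity a zero-momentum
global Leray–Hopf solution with a ν-UNIFORM pointwise energy bound that satisfies the energy equality —
the summit's saturation half `Re ~ Gr^{1/2}` plus regularity-in-the-energy-class of the witnesses) and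
`stub_noLeakOfEnergyEquality` (provable now, M/L: bookkeeping of Cesàro means under the equality, using
`Torus.IsLerayHopfOn.intervalIntegral_dissipation_eq` and `longTimeAvgSup_le_const`).
Composition `JetPairNoLeakFamily_of` is real: harmonic viscosities `ν_j = ν₁/(j+1)`, countable choice of the
witnesses, `E ↦ 2E`, `θ = 1`.
-/

namespace Summit.AnomalousDissipation.AnomalousDissipation.Cruxes.JetPairZerothLaw.EnergyEqualityFamily

set_option linter.dupNamespace false

open Filter Topology MeasureTheory
open scoped InnerProductSpace
open Literature.Analysis.FunctionSpaces Literature.Analysis.FluidPDE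

/-- The ∃-piece, verbatim (child 2 of the split of `JetPairZerothLaw`). -/
def JetPairNoLeakFamily : Prop :=
  ∃ (ρ : ℝ) (a : UnitAddTorus (Fin 3)) (φ : UnitAddTorus (Fin 3) → ℝ) (f : UnitAddTorus (Fin 3) → EuclideanSpace ℝ (Fin 3)), (0 < ρ ∧ 4 * ρ < ‖a + a‖ ∧ Literature.Analysis.FunctionSpaces.Torus.IsSmooth φ ∧ (∀ x, 0 ≤ φ x) ∧ (∀ x : UnitAddTorus (Fin 3), ρ ≤ ‖x‖ → φ x = 0) ∧ MeasureTheory.integral MeasureTheory.volume (fun x => φ x) = 1 ∧ Literature.Analysis.FunctionSpaces.Torus.IsSmooth f ∧ Literature.Analysis.FunctionSpaces.Torus.IsDivFree f ∧ Literature.Analysis.FunctionSpaces.Torus.HasZeroMean f ∧ (∀ w : UnitAddTorus (Fin 3) → EuclideanSpace ℝ (Fin 3), Literature.Analysis.FunctionSpaces.Torus.IsSmooth w → Literature.Analysis.FunctionSpaces.Torus.IsDivFree w → MeasureTheory.integral MeasureTheory.volume (fun x => inner ℝ (f x) (w x)) = MeasureTheory.integral MeasureTheory.volume (fun x => (φ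 (x - a) - φ (x + a)) * inner ℝ (w x) (EuclideanSpace.single (2 : Fin 3) (1 : ℝ) : EuclideanSpace ℝ (Fin 3))))) ∧ ∃ (E θ : ℝ) (ν : ℕ → ℝ) (u₀ : ℕ → UnitAddTorus (Fin 3) → EuclideanSpace ℝ (Fin 3)) (u : ℕ → ℝ → UnitAddTorus (Fin 3) → EuclideanSpace ℝ (Fin 3)), 0 < θ ∧ (∀ j, 0 < ν j) ∧ Filter.Tendsto ν Filter.atTop (nhds 0) ∧ (∀ j, Literature.Analysis.FunctionSpaces.Torus.HasZeroMean (u₀ j)) ∧ (∀ j, Literature.Analysis.FluidPDE.Torus.IsGlobalLerayHopf (ν j) (fun _ => f) (u₀ j) (u j)) ∧ (∀ j, Literature.Analysis.FluidPDE.meanEnergy (u j) ≤ E) ∧ ∀ j, θ * Literature.Analysis.FluidPDE.longTimeAvgSup (fun t => MeasureTheory.integral MeasureTheory.volume (fun x => inner ℝ (f x) (u j t x))) ≤ Literature.Analysis.FluidPDE.meanDissipation (ν j) (u j)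

/-- **stub (HARDEST): a ν-uniformly bounded, zero-momentum, ENERGY-EQUALITY solution at every small
viscosity, for some jet pair.** Some jet-pair configuration, a level `E` and `ν₁ > 0` such that for every
`0 < ν ≤ ν₁` there are a zero-momentum datum and a global Leray–Hopf solution driven by `f` with
`kineticEnergy (u t) ≤ E` for all `t ≥ 0` (uniformly in `ν`: turbulent saturation) satisfying the energy
EQUALITY from `0` (no Leray–Hopf defect). -/
theorem stub_energyEqualityBoundedFamily :
    ∃ (ρ : ℝ) (a : UnitAddTorus (Fin 3)) (φ : UnitAddTorus (Fin 3) → ℝ) (f : UnitAddTorus (Fin 3) → EuclideanSpace ℝ (Fin 3)), (0 < ρ ∧ 4 * ρ < ‖a + a‖ ∧ Literature.Analysis.FunctionSpaces.Torus.IsSmooth φ ∧ (∀ x, 0 ≤ φ x) ∧ (∀ x : UnitAddTorus (Fin 3), ρ ≤ ‖x‖ → φ x = 0) ∧ MeasureTheory.integral MeasureTheory.volume (fun x => φ x) = 1 ∧ Literature.Analysis.FunctionSpaces.Torus.IsSmooth f ∧ Literature.Analysis.FunctionSpaces.Torus.IsDivFree f ∧ Literature.Analysis.FunctionSpaces.Torus.HasZeroMean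 f ∧ (∀ w : UnitAddTorus (Fin 3) → EuclideanSpace ℝ (Fin 3), Literature.Analysis.FunctionSpaces.Torus.IsSmooth w → Literature.Analysis.FunctionSpaces.Torus.IsDivFree w → MeasureTheory.integral MeasureTheory.volume (fun x => inner ℝ (f x) (w x)) = MeasureTheory.integral MeasureTheory.volume (fun x => (φ (x - a) - φ (x + a)) * inner ℝ (w x) (EuclideanSpace.single (2 : Fin 3) (1 : ℝ) : EuclideanSpace ℝ (Fin 3))))) ∧ ∃ (E ν₁ : ℝ), 0 < ν₁ ∧ ∀ ν : ℝ, 0 < ν → ν ≤ ν₁ → ∃ (u₀ : UnitAddTorus (Fin 3) → EuclideanSpace ℝ (Fin 3)) (u : ℝ → UnitAddTorus (Fin 3) → EuclideanSpace ℝ (Fin 3)), Torus.HasZeroMean u₀ ∧ Torus.IsGlobalLerayHopf ν (fun _ => f) u₀ u ∧ (∀ t : ℝ, 0 ≤ t → Torus.kineticEnergy (u t) ≤ E) ∧ (∀ t : ℝ, 0 ≤ t → Torus.kineticEnergy (u t) + ν * (∫⁻ τ in Set.Ioo 0 t, Torus.eGradNormSq (u τ)).toReal = Torus.kineticEnergy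 u₀ + ∫ τ in (0 : ℝ)..t, ∫ x, ⟪f x, u τ x⟫_ℝ) := by
  sorry

/-- **stub: energy equality ⇒ no leak** (provable now). For a global Leray–Hopf solution with
`kineticEnergy (u t) ≤ E` for `t ≥ 0` that satisfies the energy equality from `0`:
`meanEnergy u ≤ 2E` (`longTimeAvgSup_le_const`) and `⟨f·u⟩ ≤ ν⟨‖∇u‖²⟩` — in fact equality: the Cesàro
means of power and dissipation differ by `(E(u₀) − E(u T))/T → 0`
(`Torus.IsLerayHopfOn.intervalIntegral_dissipation_eq` converts the `lintegral` dissipation). -/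
theorem stub_noLeakOfEnergyEquality :
    ∀ (ν : ℝ) (f : UnitAddTorus (Fin 3) → EuclideanSpace ℝ (Fin 3)) (u₀ : UnitAddTorus (Fin 3) → EuclideanSpace ℝ (Fin 3)) (u : ℝ → UnitAddTorus (Fin 3) → EuclideanSpace ℝ (Fin 3)) (E : ℝ), 0 < ν → Torus.IsSmooth f → Torus.HasZeroMean f → Torus.IsGlobalLerayHopf ν (fun _ => f) u₀ u → (∀ t : ℝ, 0 ≤ t → Torus.kineticEnergy (u t) ≤ E) → (∀ t : ℝ, 0 ≤ t → Torus.kineticEnergy (u t) + ν * (∫⁻ τ in Set.Ioo 0 t, Torus.eGradNormSq (u τ)).toReal = Torus.kineticEnergy u₀ + ∫ τ in (0 : ℝ)..t, ∫ x, ⟪f x, u τ x⟫_ℝ) → meanEnergy u ≤ 2 * E ∧ meanPower f u ≤ meanDissipation ν u := by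
  sorry

/-- **Composition (kernel-checked, no sorry): the two stubs give the ∃-piece** with `E ↦ 2E`, `θ = 1`,
along the harmonic viscosities `ν_j = ν₁/(j+1)` (countable choice of the witnesses). -/
theorem JetPairNoLeakFamily_of
    (hFam : ∃ (ρ : ℝ) (a : UnitAddTorus (Fin 3)) (φ : UnitAddTorus (Fin 3) → ℝ) (f : UnitAddTorus (Fin 3) → EuclideanSpace ℝ (Fin 3)), (0 < ρ ∧ 4 * ρ < ‖a + a‖ ∧ Literature.Analysis.FunctionSpaces.Torus.IsSmooth φ ∧ (∀ x, 0 ≤ φ x) ∧ (∀ x : UnitAddTorus (Fin 3), ρ ≤ ‖x‖ → φ x = 0) ∧ MeasureTheory.integral MeasureTheory.volume (fun x => φ x) = 1 ∧ Literature.Analysis.FunctionSpaces.Torus.IsSmooth f ∧ Literature.Analysis.FunctionSpaces.Torus.IsDivFree f ∧ Literature.Analysis.FunctionSpaces.Torus.HasZeroMean f ∧ (∀ w : UnitAddTorus (Fin 3) → EuclideanSpace ℝ (Fin 3), Literature.Analysis.FunctionSpaces.Torus.IsSmooth w → Literature.Analysis.FunctionSpaces.Torus.IsDivFree w → MeasureTheory.integral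 MeasureTheory.volume (fun x => inner ℝ (f x) (w x)) = MeasureTheory.integral MeasureTheory.volume (fun x => (φ (x - a) - φ (x + a)) * inner ℝ (w x) (EuclideanSpace.single (2 : Fin 3) (1 : ℝ) : EuclideanSpace ℝ (Fin 3))))) ∧ ∃ (E ν₁ : ℝ), 0 < ν₁ ∧ ∀ ν : ℝ, 0 < ν → ν ≤ ν₁ → ∃ (u₀ : UnitAddTorus (Fin 3) → EuclideanSpace ℝ (Fin 3)) (u : ℝ → UnitAddTorus (Fin 3) → EuclideanSpace ℝ (Fin 3)), Torus.HasZeroMean u₀ ∧ Torus.IsGlobalLerayHopf ν (fun _ => f) u₀ u ∧ (∀ t : ℝ, 0 ≤ t → Torus.kineticEnergy (u t) ≤ E) ∧ (∀ t : ℝ, 0 ≤ t → Torus.kineticEnergy (u t) + ν * (∫⁻ τ in Set.Ioo 0 t, Torus.eGradNormSq (u τ)).toReal = Torus.kineticEnergy u₀ + ∫ τ in (0 : ℝ)..t, ∫ x, ⟪f x, u τ x⟫_ℝ))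
    (hNoLeak : ∀ (ν : ℝ) (f : UnitAddTorus (Fin 3) → EuclideanSpace ℝ (Fin 3)) (u₀ : UnitAddTorus (Fin 3) → EuclideanSpace ℝ (Fin 3)) (u : ℝ → UnitAddTorus (Fin 3) → EuclideanSpace ℝ (Fin 3)) (E : ℝ), 0 < ν → Torus.IsSmooth f → Torus.HasZeroMean f → Torus.IsGlobalLerayHopf ν (fun _ => f) u₀ u → (∀ t : ℝ, 0 ≤ t → Torus.kineticEnergy (u t) ≤ E) → (∀ t : ℝ, 0 ≤ t → Torus.kineticEnergy (u t) + ν * (∫⁻ τ in Set.Ioo 0 t, Torus.eGradNormSq (u τ)).toReal = Torus.kineticEnergy u₀ + ∫ τ in (0 : ℝ)..t, ∫ x, ⟪f x, u τ x⟫_ℝ) → meanEnergy u ≤ 2 * E ∧ meanPower f u ≤ meanDissipation ν u) :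
    JetPairNoLeakFamily := by
  obtain ⟨ρ, a, φ, f, hcfg, E, ν₁, hν₁, hfam⟩ := hFam
  have hcfg' := hcfg
  obtain ⟨-, -, -, -, -, -, hfs, -, hfm, -⟩ := hcfg'
  -- harmonic viscosities
  set ν : ℕ → ℝ := fun j => ν₁ / ((j : ℝ) + 1) with hνdef
  have hjpos : ∀ j : ℕ, (0 : ℝ) < (j : ℝ) + 1 := fun j => by positivity
  have hνpos : ∀ j, 0 < ν j := fun j => div_pos hν₁ (hjpos j)
  have hνle : ∀ j, ν j ≤ ν₁ := fun j => by
    rw [hνdef]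
    refine div_le_self hν₁.le ?_
    have : (0 : ℝ) ≤ (j : ℝ) := Nat.cast_nonneg j
    linarith
  have hνT : Tendsto ν atTop (𝓝 0) := by
    have h := (tendsto_const_div_atTop_nhds_zero_nat ν₁).comp (tendsto_add_atTop_nat 1)
    refine h.congr' (Eventually.of_forall fun j => ?_)
    simp [hνdef, Function.comp, Nat.cast_succ]
  -- countable choice of the witnesses
  choose u₀ u hzm hLH hKE hEq using fun j => hfam (ν j) (hνpos j) (hνle j)
  refine ⟨ρ, a, φ, f, hcfg, 2 * E, 1, ν, u₀, u, one_pos, hνpos, hνT, hzm, hLH, fun j => ?_, fun j => ?_⟩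
  · exact (hNoLeak (ν j) f (u₀ j) (u j) E (hνpos j) hfs hfm (hLH j) (hKE j) (hEq j)).1
  · have h := (hNoLeak (ν j) f (u₀ j) (u j) E (hνpos j) hfs hfm (hLH j) (hKE j) (hEq j)).2
    rw [one_mul]
    exact h

/-- The registered stubs compose to the piece. -/
theorem JetPairNoLeakFamily_holds_of_stubs : JetPairNoLeakFamily :=
  JetPairNoLeakFamily_of stub_energyEqualityBoundedFamily stub_noLeakOfEnergyEquality

end Summit.AnomalousDissipation.AnomalousDissipation.Cruxes.JetPairZerothLaw.EnergyEqualityFamily
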